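import Summits.BirchSwinnertonDyer.BirchSwinnertonDyer.Theorems.AlignedTransportAtTwoMainConjectureOfRankZeroBSDAtTwoCubicOffStratumFukudaIndexDoors
import Literature.NumberTheory.IwasawaTheory.ClassicalMuVanishesLayerOneUnitCertificateTwo
import HarnessLib

/-!
# Route `AlignedTransportAtTwo`, crux C2 `MainConjectureOfRankZeroBSDAtTwo` (stmt-BirchSwinnertonDyer-22298):
# THE LAYER-ONE UNIT DOOR INTO `MC₂(W)` — off the stratum, when Chevalley's door at `ℚ(β) → ℚ(β,√2)` is void (the fundamental unit is a dyadic
# norm), ONE unit `A(θ) + B(θ)√2` of `ℚ(β,√2)` certified in `ℤ[θ] = 𝓞_{ℚ(β)}` gives `μ₂ = λ₂ = 0` for the cubic field and `MC₂(W)`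

HONEST FRAMING (cell `bsd-f1-sign2`, WIDTH-5 attached prover seat `bsd-line-att-p3` gen 41 on line `birth` of the lead `bsd-line-att-p2`;
`--supports` stmt-BirchSwinnertonDyer-22298, closes nothing; BSD is NOT proved by any of this; the crux C2, its verdict «blocked-on
`Rank1Residual.GreenbergMuConjectureIrreducible`» and every registered stub are untouched).  THEOREMS ONLY — no definition, no named fact, no `sorry`.

WHY.  On the off-stratum sub-cell `Δ_min ≡ 5 (mod 8)` of the seed cell the cubic `2`-torsion field `K = ℚ(β)` has `2 = 𝔭₁𝔭₂` (`f = 1, 2`); with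
`h(K)` odd, Chevalley's door at the first layer `K → K₁ = K(√2)` (att-p5 g26/g28/g29 `…CubicOffStratumFukudaIndexDoors`, `…CubicChevalleyUnitSignDoors`)
fires iff the fundamental unit `ε` is NOT a dyadic norm (`σ₁(ε) ≡ ±3 (mod 8)`; seeds `307b1`, `139a1`, …).  When `σ₁(ε) ≡ ±1 (mod 8)` (census class
`u7`/`u1` of `ODDBRANCH-att-p5-g31`: `Δ = −1099, −1187, −1259, …`) one has `e₁ ≥ 1` and the door is void; the next door sits at the layer
`K₁ → K₂ = K₁(√(2+√2))` and needs ONE unit of the sextic `K₁` that is not a norm from `K₂`.  The Literature file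
`IwasawaTheory/ClassicalMuVanishesLayerOneUnitCertificateTwo.lean` (this seat) makes that a computation in `𝓞_K` ALONE: a prime `𝔭₁` of norm `2`
with `2 ∉ 𝔭₁²`, and `A, B, C, D, π₁, d, γ₀, γ₁ ∈ 𝓞_K` with `AC + 2BD = 1`, `AD + BC = 0`, `π₁ ∈ 𝔭₁ ∖ 𝔭₁²`, `d, γ₀ ∉ 𝔭₁`, `d(A − 1) = π₁²γ₀`,
`dB = π₁²γ₁`.

WHAT.
* **`classicalMuVanishes_adjoin_of_layerOneUnitCert`** — `W` globally minimal, good ordinary at `2`, no rational `2`-torsion abscissa, OFF the Kilford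
  stratum, `β` a root of the `2`-division cubic; displayed: `h(ℚ(β))` odd, the prime `𝔭₁` and the eight elements of `𝓞 ℚ(β)` above ⟹ every cyclotomic
  `ℤ₂`-extension of `ℚ(β)` has `μ₂ = 0` AND `λ₂ = 0` (`e_m = e_1` for `m ≥ 1`).  Fukuda's index `0` is att-p5 g28's
  `totallyRamifiedFrom_zero_adjoin_of_isOrdinaryAt_two`, «at most two primes above `2`» is `ncard_adjoin_le_two_of_not_onKilfordStratumAtTwo`.
* **`mazurMainConjecture_two_of_muIneqRel_of_layerOneUnitCert`** — PRINT⁵ {Kato 17.4 (1)(2) at `2`, Greenberg 4.1, period unit, modularity, GZK} +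
  MuIneqʳ (registered stub verbatim) + the cell hypotheses (`Δ_W < 0`, `r_an = 0`, analytic `μ₂ = 0`, `BSD₂(W)`) + the same displayed data ⟹ `MC₂(W)`
  (att-p5 g24's cubic carrier road `mazurMainConjecture_two_of_muIneqRel_of_classicalMu_cubicField_of_Δ_neg`).

CONDITIONAL theorems (PRINT⁵, MuIneqʳ displayed); nothing is asserted about any curve's class number or units (each certificate is a finite search in
`ℤ[θ]²` per seed — CENSUS ASK in the crux memo `LAYER-ONE-UNIT-DOOR-att-p3-g41.md`); nothing is closed; BSD is not proved.

References: [Fukuda1994] Thm. 1 (1), p. 264; [Lang1990] Ch. 13 §4, Lemma 4.1–4.2; [Omeara1963] §63B (63:10); [Washington1997] §13.1, §13.3 Prop. 13.22;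
[Kato2004Asterisque] Thm. 17.4 (1)(2) (p. 273); [GreenbergLNM1716] Thm. 4.1 (p. 102), Conj. 1.11 (p. 58); [Iwasawa1973MuInvariants] Thm. 2/3; tree:
att-p5 g24 `…CubicCarrierRoad`, g28 `…CubicOffStratumFukudaIndex{,Doors}`, `…CubicOffStratumPrimes`; this seat's Literature files
`NumberFields/QuadraticSqrtTwoNormTwoPrimeCertificate`, `IwasawaTheory/ClassicalMuVanishesLayerOneUnitCertificateTwo`.
-/

set_option linter.dupNamespace false
set_option autoImplicit false

noncomputable section

open scoped Classical NumberField nonZeroDivisors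

namespace Summit.BirchSwinnertonDyer.BirchSwinnertonDyer.Theorems.AlignedTransportAtTwoCubicLayerOneUnitDoor

open NumberField IsDedekindDomain Polynomial WeierstrassCurve IntermediateField CongruenceSubgroup
  Literature.NumberTheory.IwasawaTheory Literature.NumberTheory.GaloisRepresentations
  Literature.NumberTheory.EllipticCurves Literature.NumberTheory.EllipticCurves.Greenberg1999
  Literature.NumberTheory.EllipticCurves.ModularForms
  Literature.NumberTheory.EllipticCurves.Rank1Residual
  Literature.NumberTheory.EllipticCurves.Module
  Summit.BirchSwinnertonDyer.Rank1Residual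
  Summit.BirchSwinnertonDyer.Rank1Residual.X1.MuLambda
  Summit.BirchSwinnertonDyer.Rank1Residual.X5
  Summit.BirchSwinnertonDyer.Rank1Residual.F1Sign2
  Summit.BirchSwinnertonDyer.BirchSwinnertonDyer.Theorems.Rank1ResidualX1Defs
  Summit.BirchSwinnertonDyer.BirchSwinnertonDyer.Theses.AlignedTransportAtTwo
  Summit.BirchSwinnertonDyer.BirchSwinnertonDyer.Theorems.AlignedTransportAtTwoKilfordStratumShared
  Summit.BirchSwinnertonDyer.BirchSwinnertonDyer.Theorems.AlignedTransportAtTwoCubicCarrierRoad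
  Summit.BirchSwinnertonDyer.BirchSwinnertonDyer.Theorems.AlignedTransportAtTwoCubicOffStratumPrimes
  Summit.BirchSwinnertonDyer.BirchSwinnertonDyer.Theorems.AlignedTransportAtTwoCubicOffStratumFukudaIndex

variable (W : WeierstrassCurve ℚ) [W.IsElliptic]

/-! ## §1 `μ₂ = 0`, `λ₂ = 0` for the cubic `2`-torsion field from the layer-one unit certificate -/

/-- **`μ₂(ℚ(β)^{cyc}) = 0` AND `λ₂ = 0` OFF THE STRATUM FROM THE LAYER-ONE UNIT CERTIFICATE.**  `W/ℚ` globally minimal, good ordinary at `2`, no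
rational `2`-torsion abscissa, OFF the Kilford stratum (at most two primes of `ℚ(β)` above `2`), `β ∈ ℚ̄` a root of the `2`-division cubic; displayed:
`h(ℚ(β))` odd, a prime `𝔭₁` of `𝓞 ℚ(β)` of norm `2` with `2 ∉ 𝔭₁²`, and `A, B, C, D, π₁, d, γ₀, γ₁ ∈ 𝓞 ℚ(β)` with `AC + 2BD = 1`, `AD + BC = 0`,
`π₁ ∈ 𝔭₁ ∖ 𝔭₁²`, `d, γ₀ ∉ 𝔭₁`, `d(A − 1) = π₁²γ₀`, `dB = π₁²γ₁` (so that `A + B√2` is a unit of `ℚ(β, √2)` that is not a norm from `ℚ(β, √(2+√2))`).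
THEN every cyclotomic `ℤ₂`-extension of `ℚ(β)` has `e_m = e_1` for all `m ≥ 1`, `μ₂ = 0`, `λ₂ = 0` (Literature
`classicalMuVanishes_two_of_layerOne_unitCert` with Fukuda's index `0` from att-p5 g28 `totallyRamifiedFrom_zero_adjoin_of_isOrdinaryAt_two`).
[cite: Fukuda1994, Thm. 1 (1), p. 264] [cite: Lang1990, Ch. 13 §4, Lemma 4.1–4.2 (PDF pp. 203–204)] [cite: Omeara1963, §63B (63:10)] -/
theorem classicalMuVanishes_adjoin_of_layerOneUnitCert [W.IsGloballyMinimal] (hord : IsOrdinaryAt W 2)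
    (ht : ∀ x : ℚ, ¬ HasRationalTwoTorsionX W x) (hs : ¬ OnKilfordStratumAtTwo W)
    {β : AlgebraicClosure ℚ} (hβ : aeval β W.twoTorsionPolynomial.toPoly = 0)
    (hh : haveI : FiniteDimensional ℚ ↥(IntermediateField.adjoin ℚ ({β} : Set (AlgebraicClosure ℚ))) :=
        IntermediateField.adjoin.finiteDimensional ((AlgebraicClosure.isAlgebraic ℚ).isAlgebraic β).isIntegral
      haveI : NumberField ↥(IntermediateField.adjoin ℚ ({β} : Set (AlgebraicClosure ℚ))) := NumberField.mk
      ¬ 2 ∣ classNumber ↥(IntermediateField.adjoin ℚ ({β} : Set (AlgebraicClosure ℚ))))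
    (𝔭₁ : Ideal (𝓞 ↥(IntermediateField.adjoin ℚ ({β} : Set (AlgebraicClosure ℚ)))))
    (hN : haveI : FiniteDimensional ℚ ↥(IntermediateField.adjoin ℚ ({β} : Set (AlgebraicClosure ℚ))) :=
        IntermediateField.adjoin.finiteDimensional ((AlgebraicClosure.isAlgebraic ℚ).isAlgebraic β).isIntegral
      haveI : NumberField ↥(IntermediateField.adjoin ℚ ({β} : Set (AlgebraicClosure ℚ))) := NumberField.mk
      Ideal.absNorm 𝔭₁ = 2)
    (hunr : (2 : 𝓞 ↥(IntermediateField.adjoin ℚ ({β} : Set (AlgebraicClosure ℚ)))) ∉ 𝔭₁ ^ 2)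
    {A B C D π₁ d γ₀ γ₁ : 𝓞 ↥(IntermediateField.adjoin ℚ ({β} : Set (AlgebraicClosure ℚ)))}
    (hAC : A * C + 2 * B * D = 1) (hAD : A * D + B * C = 0)
    (hπ₁ : π₁ ∈ 𝔭₁) (hπ₁' : π₁ ∉ 𝔭₁ ^ 2) (hd : d ∉ 𝔭₁) (hγ₀ : γ₀ ∉ 𝔭₁)
    (hA : d * (A - 1) = π₁ ^ 2 * γ₀) (hB : d * B = π₁ ^ 2 * γ₁)
    (κP : ZpExtension ↥(IntermediateField.adjoin ℚ ({β} : Set (AlgebraicClosure ℚ))) 2) (hκP : κP.IsCyclotomic) :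
    (∀ m : ℕ, 1 ≤ m → classNumberPExp κP m = classNumberPExp κP 1) ∧ ClassicalMuVanishes κP ∧ classicalLambda κP = 0 := by
  have hirr := AlignedTransportAtTwoSeed.irr_two_of_forall_not_hasRationalTwoTorsionX W ht
  have hβint : IsIntegral ℚ β := ((AlgebraicClosure.isAlgebraic ℚ).isAlgebraic β).isIntegral
  haveI : FiniteDimensional ℚ ↥(IntermediateField.adjoin ℚ ({β} : Set (AlgebraicClosure ℚ))) :=
    IntermediateField.adjoin.finiteDimensional hβint
  haveI : NumberField ↥(IntermediateField.adjoin ℚ ({β} : Set (AlgebraicClosure ℚ))) := NumberField.mk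
  have h3 : Module.finrank ℚ ↥(IntermediateField.adjoin ℚ ({β} : Set (AlgebraicClosure ℚ))) = 3 :=
    AddKatoTwo.finrank_adjoin_root_twoTorsionPolynomial_eq_three W hirr hβ
  have hodd3 : ¬ 2 ∣ Module.finrank ℚ ↥(IntermediateField.adjoin ℚ ({β} : Set (AlgebraicClosure ℚ))) := by rw [h3]; decide
  have hs2 := ncard_adjoin_le_two_of_not_onKilfordStratumAtTwo W ht hs hβ
  have hram := totallyRamifiedFrom_zero_adjoin_of_isOrdinaryAt_two W hord ht hβ κP hκP
  refine ⟨fun m hm => ?_, ?_⟩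
  · exact classNumberPExp_eq_of_le_of_layerOne_unitCert κP hκP hodd3 hram hh hs2 𝔭₁ hN hunr hAC hAD hπ₁ hπ₁' hd hγ₀ hA hB hm
  · exact classicalMuVanishes_two_of_layerOne_unitCert κP hκP hodd3 hram hh hs2 𝔭₁ hN hunr hAC hAD hπ₁ hπ₁' hd hγ₀ hA hB

/-! ## §2 The door into `MC₂(W)` -/

variable [W.IsGloballyMinimal]

/-- **THE LAYER-ONE UNIT DOOR INTO `MC₂(W)`.**  PRINT⁵ {Kato 17.4 (1)(2) at `2` (`h17`), Greenberg 4.1 (`hGr`), period unit (`hper`), modularity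
(`hmod`), GZK (`hGZK`)} + MuIneqʳ (`hI`, the registered stub VERBATIM) + the cell hypotheses (good ordinary at `2`, no rational `2`-torsion abscissa,
`Δ_W < 0`, `r_an = 0`, analytic `μ₂ = 0` on the even branch, `BSD₂(W)`) + OFF the Kilford stratum + `β` a root of the `2`-division cubic + the displayed
data of `ℚ(β)` (`h(ℚ(β))` odd; `𝔭₁` of norm `2`, `2 ∉ 𝔭₁²`; `A, B, C, D, π₁, d, γ₀, γ₁ ∈ 𝓞 ℚ(β)` with the layer-one unit certificate) ⟹ `MC₂(W)`
(att-p5 g24's cubic carrier road ∘ §1).  For the sub-cell `Δ_min ≡ 5 (mod 8)` with `σ₁(ε) ≡ ±1 (mod 8)` this is the first door that can fire.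
[cite: Fukuda1994, Thm. 1 (1), p. 264] [cite: Kato2004Asterisque, Thm. 17.4 (1)(2) (p. 273)] [cite: GreenbergLNM1716, Thm. 4.1 (p. 102) and Conj. 1.11 (p. 58)]
[cite: Iwasawa1973MuInvariants, Thm. 2 and Thm. 3] [cite: Omeara1963, §63B (63:10)] -/
theorem mazurMainConjecture_two_of_muIneqRel_of_layerOneUnitCert
    (h17 : ∀ [NeZero (W.conductorNorm ℤ)] (f : CuspForm (Gamma0 (W.conductorNorm ℤ)) 2),
      kato_divisibility_allPrimes W 2 (f := f))
    (hGr : Greenberg1999.thm41_charValue_rankZero_anyPrime)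
    (hper : realPeriodRat_eq_unit_mul_plusPeriod_two) (hmod : nonempty_modularParametrizationData)
    (hGZK : rank_eq_analyticRank_of_analyticRank_le_one)
    (hI : ∀ (W : WeierstrassCurve ℚ) [W.IsElliptic] [W.IsGloballyMinimal], IsOrdinaryAt W 2 →
      (∀ x : ℚ, ¬ HasRationalTwoTorsionX W x) →
      ∀ (κ : ZpExtension ℚ 2) (γ : Field.absoluteGaloisGroup ℚ), κ.IsCyclotomic →
      κ.IsTopGenerator γ → IsCyclotomicVariable 2 γ →
      ∀ ⦃N : ℕ⦄ [NeZero N] (f : CuspForm (Gamma0 N) 2), IsNewformOf W f →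
      ∀ Gp : IwasawaAlgebra 2, iwasawaToPowerSeries 2 Gp = padicLFunction f (unitRoot W 2 : ℚ_[2]) →
      ∀ (D : W.SelmerDualData κ γ) (Yr : W.FineSelmerDualDataRelaxedInf κ γ),
        lengthAt (IwasawaAlgebra 2) D.X ⟨IwasawaAlgebra.augIdealP 2, IwasawaAlgebra.isPrime_augIdealP_holds 2⟩ ≤
          lengthAt (IwasawaAlgebra 2) (IwasawaAlgebra 2 ⧸ Ideal.span {Gp})
              ⟨IwasawaAlgebra.augIdealP 2, IwasawaAlgebra.isPrime_augIdealP_holds 2⟩ +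
            lengthAt (IwasawaAlgebra 2) Yr.X ⟨IwasawaAlgebra.augIdealP 2, IwasawaAlgebra.isPrime_augIdealP_holds 2⟩)
    (hord : IsOrdinaryAt W 2) (ht : ∀ x : ℚ, ¬ HasRationalTwoTorsionX W x) (hΔ : W.Δ < 0) (hr : W.analyticRank = 0)
    (hμan : ∀ ⦃N : ℕ⦄ [NeZero N] (f : CuspForm (Gamma0 N) 2), IsNewformOf W f →
      ∀ G : IwasawaAlgebra 2, IsEvenBranchLiftAtTwo W f G → red G ≠ 0)
    (hbsd : BSDp W 2) (hs : ¬ OnKilfordStratumAtTwo W)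
    {β : AlgebraicClosure ℚ} (hβ : aeval β W.twoTorsionPolynomial.toPoly = 0)
    (hh : haveI : FiniteDimensional ℚ ↥(IntermediateField.adjoin ℚ ({β} : Set (AlgebraicClosure ℚ))) :=
        IntermediateField.adjoin.finiteDimensional ((AlgebraicClosure.isAlgebraic ℚ).isAlgebraic β).isIntegral
      haveI : NumberField ↥(IntermediateField.adjoin ℚ ({β} : Set (AlgebraicClosure ℚ))) := NumberField.mk
      ¬ 2 ∣ classNumber ↥(IntermediateField.adjoin ℚ ({β} : Set (AlgebraicClosure ℚ))))
    (𝔭₁ : Ideal (𝓞 ↥(IntermediateField.adjoin ℚ ({β} : Set (AlgebraicClosure ℚ)))))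
    (hN : haveI : FiniteDimensional ℚ ↥(IntermediateField.adjoin ℚ ({β} : Set (AlgebraicClosure ℚ))) :=
        IntermediateField.adjoin.finiteDimensional ((AlgebraicClosure.isAlgebraic ℚ).isAlgebraic β).isIntegral
      haveI : NumberField ↥(IntermediateField.adjoin ℚ ({β} : Set (AlgebraicClosure ℚ))) := NumberField.mk
      Ideal.absNorm 𝔭₁ = 2)
    (hunr : (2 : 𝓞 ↥(IntermediateField.adjoin ℚ ({β} : Set (AlgebraicClosure ℚ)))) ∉ 𝔭₁ ^ 2)
    {A B C D π₁ d γ₀ γ₁ : 𝓞 ↥(IntermediateField.adjoin ℚ ({β} : Set (AlgebraicClosure ℚ)))}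
    (hAC : A * C + 2 * B * D = 1) (hAD : A * D + B * C = 0)
    (hπ₁ : π₁ ∈ 𝔭₁) (hπ₁' : π₁ ∉ 𝔭₁ ^ 2) (hd : d ∉ 𝔭₁) (hγ₀ : γ₀ ∉ 𝔭₁)
    (hA : d * (A - 1) = π₁ ^ 2 * γ₀) (hB : d * B = π₁ ^ 2 * γ₁) :
    MazurMainConjecture W 2 :=
  mazurMainConjecture_two_of_muIneqRel_of_classicalMu_cubicField_of_Δ_neg W h17 hGr hper hmod hGZK hI hord ht hΔ hr hμan hbsd hβ
    fun κP hκP => (classicalMuVanishes_adjoin_of_layerOneUnitCert W hord ht hs hβ hh 𝔭₁ hN hunr hAC hAD hπ₁ hπ₁' hd hγ₀ hA hB κP hκP).2.1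

/-! ## §3 The principal form `𝔭₁ = (π₁)` (class number one seeds): every side condition as an identity in `𝓞 ℚ(β)` -/

/-- `π ∉ (π)²` for a non-zero non-unit `π` of a domain. [folklore] -/
private theorem not_mem_span_singleton_sq {R : Type*} [CommRing R] [IsDomain R] {π : R} (hπ0 : π ≠ 0) (hπu : ¬ IsUnit π) :
    π ∉ Ideal.span {π} ^ 2 := by
  rw [Ideal.span_singleton_pow, Ideal.mem_span_singleton]
  rintro ⟨x, hx⟩
  apply hπu
  have h1 : π * (1 - π * x) = 0 := by linear_combination hx
  rcases mul_eq_zero.mp h1 with h | h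
  · exact absurd h hπ0
  · exact IsUnit.of_mul_eq_one x (by linear_combination -h)

/-- `x ≡ 1 (mod I)` (witnessed: `x − 1 = π y`, `π ∈ I`) and `I ≠ ⊤` give `x ∉ I`. [folklore] -/
private theorem not_mem_of_sub_one_eq {R : Type*} [CommRing R] {I : Ideal R} (hI : I ≠ ⊤) {x y π : R} (hπ : π ∈ I)
    (h : x - 1 = π * y) : x ∉ I := fun hx => hI (I.eq_top_of_isUnit_mem (x := 1)
  (by have : x - π * y ∈ I := I.sub_mem hx (I.mul_mem_right _ hπ); rwa [show x - π * y = 1 by linear_combination h] at this) isUnit_one)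

/-- **THE LAYER-ONE UNIT DOOR INTO `MC₂(W)`, PRINCIPAL FORM** (`h(ℚ(β)) = 1` seeds, `𝔭₁ = (π₁)`): the side conditions of
`mazurMainConjecture_two_of_muIneqRel_of_layerOneUnitCert` become identities in `𝓞 ℚ(β)` — displayed: `h(ℚ(β))` odd, `N((π₁)) = 2`, `2 ∉ (π₁)²`
(e.g. from `2 ∤ d_{ℚ(β)}`, Literature `two_not_mem_sq_of_not_dvd_discr`), and `A, B, C, D, d, γ₀, γ₁, y_d, y_γ ∈ 𝓞 ℚ(β)` with `AC + 2BD = 1`,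
`AD + BC = 0`, `d − 1 = π₁ y_d`, `γ₀ − 1 = π₁ y_γ`, `d(A − 1) = π₁²γ₀`, `dB = π₁²γ₁` (`π₁ ∉ (π₁)²` is automatic, `d, γ₀ ∉ (π₁)` from the two
congruences).  With PRINT⁵ + MuIneqʳ + the cell hypotheses (`Δ_W < 0`) + OFF the stratum ⟹ `MC₂(W)`. [cite: Fukuda1994, Thm. 1 (1), p. 264]
[cite: Kato2004Asterisque, Thm. 17.4 (1)(2) (p. 273)] [cite: GreenbergLNM1716, Thm. 4.1 (p. 102) and Conj. 1.11 (p. 58)] [cite: Omeara1963, §63B (63:10)] -/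
theorem mazurMainConjecture_two_of_muIneqRel_of_layerOneUnitCert_principal
    (h17 : ∀ [NeZero (W.conductorNorm ℤ)] (f : CuspForm (Gamma0 (W.conductorNorm ℤ)) 2),
      kato_divisibility_allPrimes W 2 (f := f))
    (hGr : Greenberg1999.thm41_charValue_rankZero_anyPrime)
    (hper : realPeriodRat_eq_unit_mul_plusPeriod_two) (hmod : nonempty_modularParametrizationData)
    (hGZK : rank_eq_analyticRank_of_analyticRank_le_one)
    (hI : ∀ (W : WeierstrassCurve ℚ) [W.IsElliptic] [W.IsGloballyMinimal], IsOrdinaryAt W 2 →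
      (∀ x : ℚ, ¬ HasRationalTwoTorsionX W x) →
      ∀ (κ : ZpExtension ℚ 2) (γ : Field.absoluteGaloisGroup ℚ), κ.IsCyclotomic →
      κ.IsTopGenerator γ → IsCyclotomicVariable 2 γ →
      ∀ ⦃N : ℕ⦄ [NeZero N] (f : CuspForm (Gamma0 N) 2), IsNewformOf W f →
      ∀ Gp : IwasawaAlgebra 2, iwasawaToPowerSeries 2 Gp = padicLFunction f (unitRoot W 2 : ℚ_[2]) →
      ∀ (D : W.SelmerDualData κ γ) (Yr : W.FineSelmerDualDataRelaxedInf κ γ),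
        lengthAt (IwasawaAlgebra 2) D.X ⟨IwasawaAlgebra.augIdealP 2, IwasawaAlgebra.isPrime_augIdealP_holds 2⟩ ≤
          lengthAt (IwasawaAlgebra 2) (IwasawaAlgebra 2 ⧸ Ideal.span {Gp})
              ⟨IwasawaAlgebra.augIdealP 2, IwasawaAlgebra.isPrime_augIdealP_holds 2⟩ +
            lengthAt (IwasawaAlgebra 2) Yr.X ⟨IwasawaAlgebra.augIdealP 2, IwasawaAlgebra.isPrime_augIdealP_holds 2⟩)
    (hord : IsOrdinaryAt W 2) (ht : ∀ x : ℚ, ¬ HasRationalTwoTorsionX W x) (hΔ : W.Δ < 0) (hr : W.analyticRank = 0)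
    (hμan : ∀ ⦃N : ℕ⦄ [NeZero N] (f : CuspForm (Gamma0 N) 2), IsNewformOf W f →
      ∀ G : IwasawaAlgebra 2, IsEvenBranchLiftAtTwo W f G → red G ≠ 0)
    (hbsd : BSDp W 2) (hs : ¬ OnKilfordStratumAtTwo W)
    {β : AlgebraicClosure ℚ} (hβ : aeval β W.twoTorsionPolynomial.toPoly = 0)
    (hh : haveI : FiniteDimensional ℚ ↥(IntermediateField.adjoin ℚ ({β} : Set (AlgebraicClosure ℚ))) :=
        IntermediateField.adjoin.finiteDimensional ((AlgebraicClosure.isAlgebraic ℚ).isAlgebraic β).isIntegral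
      haveI : NumberField ↥(IntermediateField.adjoin ℚ ({β} : Set (AlgebraicClosure ℚ))) := NumberField.mk
      ¬ 2 ∣ classNumber ↥(IntermediateField.adjoin ℚ ({β} : Set (AlgebraicClosure ℚ))))
    {π₁ A B C D d γ₀ γ₁ yd yγ : 𝓞 ↥(IntermediateField.adjoin ℚ ({β} : Set (AlgebraicClosure ℚ)))}
    (hN : haveI : FiniteDimensional ℚ ↥(IntermediateField.adjoin ℚ ({β} : Set (AlgebraicClosure ℚ))) :=
        IntermediateField.adjoin.finiteDimensional ((AlgebraicClosure.isAlgebraic ℚ).isAlgebraic β).isIntegral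
      haveI : NumberField ↥(IntermediateField.adjoin ℚ ({β} : Set (AlgebraicClosure ℚ))) := NumberField.mk
      Ideal.absNorm (Ideal.span {π₁}) = 2)
    (hunr : (2 : 𝓞 ↥(IntermediateField.adjoin ℚ ({β} : Set (AlgebraicClosure ℚ)))) ∉ Ideal.span {π₁} ^ 2)
    (hAC : A * C + 2 * B * D = 1) (hAD : A * D + B * C = 0) (hd : d - 1 = π₁ * yd) (hγ₀ : γ₀ - 1 = π₁ * yγ)
    (hA : d * (A - 1) = π₁ ^ 2 * γ₀) (hB : d * B = π₁ ^ 2 * γ₁) :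
    MazurMainConjecture W 2 := by
  have hβint : IsIntegral ℚ β := ((AlgebraicClosure.isAlgebraic ℚ).isAlgebraic β).isIntegral
  haveI : FiniteDimensional ℚ ↥(IntermediateField.adjoin ℚ ({β} : Set (AlgebraicClosure ℚ))) :=
    IntermediateField.adjoin.finiteDimensional hβint
  haveI : NumberField ↥(IntermediateField.adjoin ℚ ({β} : Set (AlgebraicClosure ℚ))) := NumberField.mk
  have htop : Ideal.span {π₁} ≠ (⊤ : Ideal (𝓞 ↥(IntermediateField.adjoin ℚ ({β} : Set (AlgebraicClosure ℚ))))) := fun h => by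
    rw [h, Ideal.absNorm_top] at hN; exact absurd hN (by norm_num)
  have hπu : ¬ IsUnit π₁ := fun h => htop (Ideal.span_singleton_eq_top.mpr h)
  have hπ0 : π₁ ≠ 0 := fun h => by
    rw [h, Ideal.span_singleton_zero] at hN
    change Ideal.absNorm (⊥ : Ideal _) = 2 at hN
    rw [Ideal.absNorm_bot] at hN; exact absurd hN (by norm_num)
  exact mazurMainConjecture_two_of_muIneqRel_of_layerOneUnitCert W h17 hGr hper hmod hGZK hI hord ht hΔ hr hμan hbsd hs hβ hh
    (Ideal.span {π₁}) hN hunr hAC hAD (Ideal.mem_span_singleton_self π₁) (not_mem_span_singleton_sq hπ0 hπu)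
    (not_mem_of_sub_one_eq htop (Ideal.mem_span_singleton_self π₁) hd)
    (not_mem_of_sub_one_eq htop (Ideal.mem_span_singleton_self π₁) hγ₀) hA hB

end Summit.BirchSwinnertonDyer.BirchSwinnertonDyer.Theorems.AlignedTransportAtTwoCubicLayerOneUnitDoor

end
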